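import Summits.QuantumAdvantage.QuantumAdvantage.Theorems.DigitRung.Negative.NoTwoAdicBias

/-!
# `DigitRung` (stmt-QuantumAdvantage-2423) — exact 2-adic balance of every binary digit of a cubic discriminant (negative-side support)

Strengthens `Negative/NoTwoAdicBias.lean` from "mod 64 by `decide`" to EVERY depth `k`, in the
character-free form a digit statement wants. The substitution `(a, b, c, d) ↦ (s²a, sb, c, s⁻¹d)`
(i.e. `f ↦ s⁻¹·f(sx, y)`, a `GL₂ × 𝔾_m` change of variables, so it preserves every isomorphism-
invariant family of forms: maximal at `2`, given splitting type at `2`, …) multiplies the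
discriminant by `s²`; with `s = 3^{2^{k-4-v}}` one has `s² = 9^{2^{k-4-v}} ≡ 1 + 2^{k-1-v} (mod 2^{k-v})`,
whence for `a = 2ᵛ·(odd)`:

* `card_cubicDisc_eq_add_two_pow` — in ANY family `M` of binary cubic forms over `ℤ/2ᵏ` stable
  under these substitutions, the number of forms with discriminant `a` equals the number with
  discriminant `a + 2^{k−1}`, as soon as `k ≥ v₂(a) + 4`.

So, 2-adically, binary digit `k − 1` of the discriminant of a random form in `M` is EXACTLY fair
given all lower digits, at every depth beyond the square class (`v₂(a) ≤ 3` for maximal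
nowhere-totally-ramified cubic algebras, so every digit `≥ 7`): the singular series of the
digit-twisted Davenport–Heilbronn count vanishes identically (planner idea B's
"TwoAdicOddFourierVanishing", character-free), and a counterexample to `DigitRung` cannot come from
2-adic structure at any digit. Landed from the refuter's `Cruxes/DigitRung/Disproof.lean`.
-/

namespace Summit.QuantumAdvantage.DigitRung.Negative

open Finset

/-- `Disc(s⁻¹·f(sx, y)) = s²·Disc(f)`: the substitution `(a,b,c,d) ↦ (s²a, sb, c, s⁻¹d)` scales the
discriminant by `s²` (for a unit `s`). [folklore] -/
theorem cubicDisc_twist {R : Type*} [CommRing R] (s : Rˣ) (a b c d : R) :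
    cubicDisc ((s : R) ^ 2 * a) ((s : R) * b) c ((↑s⁻¹ : R) * d) = (s : R) ^ 2 * cubicDisc a b c d := by
  have h : (s : R) * (↑s⁻¹ : R) = 1 := Units.mul_inv s
  unfold cubicDisc
  have e1 : ((s : R) * b) ^ 3 * ((↑s⁻¹ : R) * d) = (s : R) ^ 2 * (b ^ 3 * d) := by
    calc ((s : R) * b) ^ 3 * ((↑s⁻¹ : R) * d) = (s : R) ^ 2 * ((s : R) * (↑s⁻¹ : R)) * (b ^ 3 * d) := by ring
      _ = (s : R) ^ 2 * (b ^ 3 * d) := by rw [h, mul_one]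
  have e2 : ((s : R) ^ 2 * a) ^ 2 * ((↑s⁻¹ : R) * d) ^ 2 = (s : R) ^ 2 * (a ^ 2 * d ^ 2) := by
    calc ((s : R) ^ 2 * a) ^ 2 * ((↑s⁻¹ : R) * d) ^ 2
        = (s : R) ^ 2 * ((s : R) * (↑s⁻¹ : R)) ^ 2 * (a ^ 2 * d ^ 2) := by ring
      _ = (s : R) ^ 2 * (a ^ 2 * d ^ 2) := by rw [h, one_pow, mul_one]
  have e3 : (s : R) ^ 2 * a * ((s : R) * b) * c * ((↑s⁻¹ : R) * d) = (s : R) ^ 2 * (a * b * c * d) := by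
    calc (s : R) ^ 2 * a * ((s : R) * b) * c * ((↑s⁻¹ : R) * d)
        = (s : R) ^ 2 * ((s : R) * (↑s⁻¹ : R)) * (a * b * c * d) := by ring
      _ = (s : R) ^ 2 * (a * b * c * d) := by rw [h, mul_one]
  calc ((s : R) * b) ^ 2 * c ^ 2 - 4 * ((s : R) ^ 2 * a) * c ^ 3 - 4 * ((s : R) * b) ^ 3 * ((↑s⁻¹ : R) * d)
        - 27 * ((s : R) ^ 2 * a) ^ 2 * ((↑s⁻¹ : R) * d) ^ 2
        + 18 * ((s : R) ^ 2 * a) * ((s : R) * b) * c * ((↑s⁻¹ : R) * d)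
      = ((s : R) * b) ^ 2 * c ^ 2 - 4 * ((s : R) ^ 2 * a) * c ^ 3
        - 4 * (((s : R) * b) ^ 3 * ((↑s⁻¹ : R) * d))
        - 27 * (((s : R) ^ 2 * a) ^ 2 * ((↑s⁻¹ : R) * d) ^ 2)
        + 18 * ((s : R) ^ 2 * a * ((s : R) * b) * c * ((↑s⁻¹ : R) * d)) := by ring
    _ = (s : R) ^ 2 * (b ^ 2 * c ^ 2 - 4 * a * c ^ 3 - 4 * b ^ 3 * d - 27 * a ^ 2 * d ^ 2
        + 18 * a * b * c * d) := by rw [e1, e2, e3]; ring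

/-- The substitution `(a, b, c, d) ↦ (s²a, sb, c, s⁻¹d)` on coefficient quadruples. -/
def twist {R : Type*} [CommRing R] (s : Rˣ) (f : R × R × R × R) : R × R × R × R :=
  ((s : R) ^ 2 * f.1, (s : R) * f.2.1, f.2.2.1, (↑s⁻¹ : R) * f.2.2.2)

/-- `twist s⁻¹ ∘ twist s = id`. [folklore] -/
theorem twist_inv_twist {R : Type*} [CommRing R] (s : Rˣ) (f : R × R × R × R) :
    twist s⁻¹ (twist s f) = f := by
  obtain ⟨a, b, c, d⟩ := f
  simp only [twist, inv_inv, Prod.mk.injEq]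
  refine ⟨?_, ?_, trivial, ?_⟩
  · rw [← mul_assoc, ← mul_pow, Units.inv_mul, one_pow, one_mul]
  · rw [← mul_assoc, Units.inv_mul, one_mul]
  · rw [← mul_assoc, Units.mul_inv, one_mul]

/-- `twist s ∘ twist s⁻¹ = id`. [folklore] -/
theorem twist_twist_inv {R : Type*} [CommRing R] (s : Rˣ) (f : R × R × R × R) :
    twist s (twist s⁻¹ f) = f := by
  simpa using twist_inv_twist s⁻¹ f

/-- In a twist-stable family, discriminant `r` and discriminant `s²·r` are equinumerous. [folklore] -/
theorem card_cubicDisc_eq_mul_unit_sq {R : Type*} [CommRing R] [DecidableEq R]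
    (M : Finset (R × R × R × R)) (hM : ∀ (s : Rˣ), ∀ f ∈ M, twist s f ∈ M) (s : Rˣ) (r : R) :
    (M.filter fun f => cubicDisc f.1 f.2.1 f.2.2.1 f.2.2.2 = r).card =
      (M.filter fun f => cubicDisc f.1 f.2.1 f.2.2.1 f.2.2.2 = (s : R) ^ 2 * r).card := by
  refine Finset.card_nbij' (twist s) (twist s⁻¹) (fun f hf => ?_) (fun f hf => ?_)
    (fun f _ => twist_inv_twist s f) (fun f _ => twist_twist_inv s f)
  · simp only [Finset.mem_coe, Finset.mem_filter] at hf ⊢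
    refine ⟨hM s f hf.1, ?_⟩
    rw [twist, cubicDisc_twist, hf.2]
  · simp only [Finset.mem_coe, Finset.mem_filter] at hf ⊢
    refine ⟨hM s⁻¹ f hf.1, ?_⟩
    rw [twist, cubicDisc_twist, hf.2, ← mul_assoc, ← mul_pow, Units.inv_mul, one_pow, one_mul]

/-- `9^{2^j} = 1 + 2^{j+3} + 2^{j+4}·t` for some `t` (the 2-adic logarithm of `9` has valuation
exactly `3`). [folklore] -/
theorem nine_pow_two_pow (j : ℕ) : ∃ t : ℕ, 9 ^ 2 ^ j = 1 + 2 ^ (j + 3) + 2 ^ (j + 4) * t := by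
  induction j with
  | zero => exact ⟨0, by norm_num⟩
  | succ j ih =>
    obtain ⟨t, ht⟩ := ih
    refine ⟨t + t ^ 2 * 2 ^ (j + 3) + 2 ^ (j + 1) + t * 2 ^ (j + 3), ?_⟩
    rw [pow_succ, pow_mul, ht]
    ring

/-- In `ℤ/2ᵏ`: `9^{2^{k-4-v}} · 2ᵛ = 2ᵛ + 2^{k-1}` for `v + 4 ≤ k`. [folklore] -/
theorem nine_pow_mul_two_pow_zmod {k v : ℕ} (hk : v + 4 ≤ k) :
    ((9 : ZMod (2 ^ k)) ^ 2 ^ (k - 4 - v)) * 2 ^ v = 2 ^ v + 2 ^ (k - 1) := by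
  obtain ⟨t, ht⟩ := nine_pow_two_pow (k - 4 - v)
  have hnat : 9 ^ 2 ^ (k - 4 - v) * 2 ^ v = 2 ^ v + 2 ^ (k - 1) + 2 ^ k * t := by
    rw [ht]
    have h1 : k - 4 - v + 3 + v = k - 1 := by omega
    have h2 : k - 4 - v + 4 + v = k := by omega
    calc (1 + 2 ^ (k - 4 - v + 3) + 2 ^ (k - 4 - v + 4) * t) * 2 ^ v
        = 2 ^ v + 2 ^ (k - 4 - v + 3 + v) + 2 ^ (k - 4 - v + 4 + v) * t := by ring
      _ = 2 ^ v + 2 ^ (k - 1) + 2 ^ k * t := by rw [h1, h2]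
  have h0 : (2 : ZMod (2 ^ k)) ^ k = 0 := by
    have := ZMod.natCast_self (2 ^ k)
    push_cast at this
    exact this
  have := congrArg (fun n : ℕ => (n : ZMod (2 ^ k))) hnat
  simp only [Nat.cast_mul, Nat.cast_pow, Nat.cast_add, Nat.cast_ofNat] at this
  rwa [h0, zero_mul, add_zero] at this

/-- **Exact 2-adic balance of every binary digit of the discriminant.** Let `M` be a family of
binary cubic forms over `ℤ/2ᵏ` stable under the substitutions `(a,b,c,d) ↦ (s²a, sb, c, s⁻¹d)`
(`s` a unit) — e.g. all forms, or the reductions of the forms whose cubic algebra over `ℤ₂` lies in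
any isomorphism-stable class (maximal, nowhere totally ramified, given splitting type). Then for
every residue `a = 2ᵛ·a₁` with `a₁` odd and `k ≥ v + 4`, the forms in `M` with discriminant `a`
and those with discriminant `a + 2^{k-1}` are equinumerous: digit `k − 1` of `Disc` is exactly
fair given the lower digits. For maximal nowhere-totally-ramified algebras `v ≤ 3`, so this covers
every digit `≥ 7`; it is the vanishing of the singular series of `Σ_f e(r·Disc f/2ᵏ)`, `r` odd.
[folklore] -/
theorem card_cubicDisc_eq_add_two_pow {k v : ℕ} (hk : v + 4 ≤ k)
    (M : Finset (ZMod (2 ^ k) × ZMod (2 ^ k) × ZMod (2 ^ k) × ZMod (2 ^ k)))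
    (hM : ∀ (s : (ZMod (2 ^ k))ˣ), ∀ f ∈ M, twist s f ∈ M)
    (a₁ : ZMod (2 ^ k)) (ha₁ : ∃ q : ZMod (2 ^ k), a₁ = 2 * q + 1) :
    (M.filter fun f => cubicDisc f.1 f.2.1 f.2.2.1 f.2.2.2 = 2 ^ v * a₁).card =
      (M.filter fun f => cubicDisc f.1 f.2.1 f.2.2.1 f.2.2.2 = 2 ^ v * a₁ + 2 ^ (k - 1)).card := by
  -- the unit `3` and `s = 3^{2^{k-4-v}}`, `s² = 9^{2^{k-4-v}}`
  have h3 : Nat.Coprime 3 (2 ^ k) := Nat.Coprime.pow_right k (by norm_num)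
  set u : (ZMod (2 ^ k))ˣ := ZMod.unitOfCoprime 3 h3 with hu
  set s : (ZMod (2 ^ k))ˣ := u ^ 2 ^ (k - 4 - v) with hs
  have hs2 : (s : ZMod (2 ^ k)) ^ 2 = (9 : ZMod (2 ^ k)) ^ 2 ^ (k - 4 - v) := by
    rw [hs, Units.val_pow_eq_pow_val, hu, ZMod.coe_unitOfCoprime, ← pow_mul, mul_comm, pow_mul]
    norm_num
  rw [card_cubicDisc_eq_mul_unit_sq M hM s (2 ^ v * a₁)]
  congr 1
  ext f
  simp only [Finset.mem_filter]
  rw [hs2, ← mul_assoc, nine_pow_mul_two_pow_zmod hk, add_mul]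
  obtain ⟨q, rfl⟩ := ha₁
  have h2k : (2 : ZMod (2 ^ k)) ^ (k - 1) * 2 = 0 := by
    rw [← pow_succ, show k - 1 + 1 = k by omega]
    have := ZMod.natCast_self (2 ^ k)
    push_cast at this
    exact this
  have : (2 : ZMod (2 ^ k)) ^ (k - 1) * (2 * q + 1) = 2 ^ (k - 1) := by
    rw [mul_add, mul_one, ← mul_assoc, h2k, zero_mul, zero_add]
  rw [this]

end Summit.QuantumAdvantage.DigitRung.Negative
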